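import Literature.Probability.LatticeModels.LayeredPlaneRotatorSusceptibilityDichotomy
import Literature.Probability.LatticeModels.PlaneRotatorTransitionCouplings
import HarnessLib

/-!
# Finite stack susceptibility ⇒ geometric decay across the layers, uniformly in the volume and WITHOUT prefactor:
# the one-site heat-bath bound `⟨cos(θ_x − θ_y)⟩_J ≤ 1 − e^{−2S_x}` and the layered plane rotator

Topic `Literature/Probability/LatticeModels`. Two classical facts about ferromagnetic plane rotators (classical XY
spins `θ_x ∈ U(1)`, Gibbs weight `exp(∑_{(x,y)} J(x,y) cos(θ_y − θ_x))` with pair couplings `J ≥ 0` on ordered pairs of a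
finite vertex set, Haar a-priori measure; the tree's `PlaneRotator.twoPoint`, inverse temperature absorbed in `J`):

* §1 **The one-site (heat-bath) bound** — folklore «finite energy»: for `x ≠ y`,
  `⟨cos(θ_x − θ_y)⟩_J ≤ 1 − exp(−2 S_x)`, `S_x := ∑_z (J(x,z) + J(z,x))` (`PlaneRotator.twoPoint_le_one_sub_exp_of_rowSum_le`).
  Proof: split the weight `w_J = w_{J₀} · w_{J₁}` into the bonds NOT touching `x` (`J₀`) and the star of `x` (`J₁`,
  `e^{−S_x} ≤ w_{J₁} ≤ e^{S_x}`); under `w_{J₀}` the spin `x` is free, so `∫ cos(θ_x − θ_y) w_{J₀} dθ = 0` (flip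
  `θ_x ↦ −θ_x`, Haar invariance — the un-normalised form of the tree's private `twoPoint_eq_zero_of_isolated` of
  `PlaneRotatorLiebRivasseauInequality.lean`, re-proved here as `integral_cosDiff_mul_ginibreWeight_eq_zero_of_isolated`);
  hence `∫ (1 − cos) w_J ≥ e^{−S_x} ∫ (1 − cos) w_{J₀} = e^{−S_x} ∫ w_{J₀} ≥ e^{−2S_x} ∫ w_J`.
  For the layered model on any finite `Λ ⊂ ℤ³` (tree `layeredXYCoupling β J∥ J⊥ Λ`, `sum_layeredXYCoupling_le`):
  `⟨cos(θ_a − θ_c)⟩_Λ ≤ 1 − exp(−2β(4J∥ + 2J⊥))` for `a ≠ c` (`twoPoint_layered_le_one_sub_exp`).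
* §2 A Bernoulli envelope (`exists_geometric_envelope`, real analysis): a bound `≤ ρ < 1` off the diagonal together with a
  block bound `≤ m^{⌊n/R⌋}` (`0 ≤ m < 1`, `R ≥ 1`) is dominated by ONE geometric law `r^n`, `r := 1 − (1 − q)/(2R) < 1`,
  `q = max(½, m, ρ)` (`q ≤ r^{2R}` by Bernoulli's inequality).
* §3 **Finite susceptibility ⇒ uniform prefactor-free geometric decay** (`exists_uniform_geometric_decay_of_summable`):
  if `∑_{z ∈ ℤ³} G^{3D,free,∞}_{β;J∥,J⊥}(0,z) < ∞` (`β, J∥, J⊥ ≥ 0`) then there is `0 ≤ r < 1` with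
  `⟨cos(θ_a − θ_c)⟩_{Λ;β,J∥,J⊥} ≤ r^{‖a − c‖_∞} ≤ r^{|ℓ(a) − ℓ(c)|}` for EVERY finite `Λ ⊂ ℤ³` and all `a, c ∈ Λ` —
  Simon–Lieb (tree `PlaneRotator.infTwoPointLayered_decay_of_summable`: `G^{∞}(x,y) ≤ m^{⌊‖x−y‖_∞/R⌋}`), Griffiths–Ginibre
  (`twoPoint_layered_le_inf`: finite volume ≤ infinite volume) and §1–§2. In the tree's transition-coupling vocabulary
  (`PlaneRotator.layeredSusceptibilityCriticalCoupling`, `K_χ^{3D}(Δ)`): the layer-decay property holds at every point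
  `ofReal(βJ∥) < K_χ^{3D}(J⊥/J∥)` of the finite-susceptibility phase of the stack
  (`exists_uniform_layer_decay_of_lt_layeredSusceptibilityCriticalCoupling`, `…_of_mul_lt_…`).

Use (cell `pub/hubbard-tc`, MO-S3 ORDER → `T_c` back-end, modelling key K5): §3 is exactly the premise shape
`LayeredXYDecayAt β J∥ J⊥ := ∃ r < 1, ∀ Λ a c, ⟨cos(θ_a − θ_c)⟩_Λ ≤ r^{|ℓ(a)−ℓ(c)|}` of the K5 dictionary
(`Summits/Ventures/CertifiedManyBodySolver/Observables/XYCertificateCeiling.lean`); with it the susceptibility-transition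
temperature `T_χ^{3D}(J∥, J⊥)` of the comparison stack is itself a row-level ceiling (sequel
`Observables/XYSusceptibilityTransitionCeiling.lean`). HONEST FRAMING: theorems about the CLASSICAL layered XY model; their use
for a material rests on K5, never certified; no value of `K_χ^{3D}` is computed here.

Presearch (D-0021): `χ < ∞ ⇒` exponential decay is Simon 1980 Thm 1.3 / Lieb 1980 Thm 4 (in the tree); the prefactor-free
finite-volume form via the one-site bound: none as a stated theorem (corpus hybrid 8 [corpus:book:friedli2017 pp. 469/473,
generic], vsearch 8, galaxy all 8 rows «Simon-Lieb inequality|…»: Grimmett, Madras–Slade — generic).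

## What this is not

NOT CLAIMED (cell `pub/hubbard-tc`, lead RULING R113): no value of `K_χ^{3D}(Δ)` (none is computed or bounded here); K5 itself
is a modelling hypothesis of the consumer, assumed there, never certified; the stiffness-currency twin is NOT obtained
(`K_χ^{3D} ≤ K_Υ^{3D}` is the wrong direction for a ceiling); no lower bound on any correlation or temperature; BESIDE-CLASS
(Q4) — no number ∕ kelvin ∕ count ∕ token of record moves. No new correlation inequality beyond Griffiths–Ginibre ∕
Simon–Lieb; nothing about electrons.

## References

* B. Simon, Comm. Math. Phys. 77 (1980) 111–126, Thm 1.3. [Simon1980CMP]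
* E. H. Lieb, Comm. Math. Phys. 77 (1980) 127–135, Thm 4, eq. (23), p. 128. [Lieb1980]
* J. Ginibre, Comm. Math. Phys. 16 (1970) 310–328, Prop. 3 / Example 4. [Ginibre1970]
* L. L. Liu, H. E. Stanley, Phys. Rev. Lett. 29 (1972) 927; Phys. Rev. B 8 (1973) 2279 (layers `(J, J, εJ)`). [LiuStanley1972]
-/

noncomputable section

open MeasureTheory Finset Filter
open scoped BigOperators ENNReal

namespace Literature.Probability.LatticeModels

namespace PlaneRotator

/-! ## §1 The one-site heat-bath bound `⟨cos(θ_x − θ_y)⟩_J ≤ 1 − e^{−2S_x}` -/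

section HeatBath

variable {V : Type*} [Fintype V] [DecidableEq V] [MeasurableSpace Circle] [BorelSpace Circle]

/-- A FREE spin is uncorrelated, un-normalised form: if `y ≠ x` carries no coupling at all then
`∫ cos(θ_x − θ_y) e^{∑ J cos} dθ = 0` (flip `θ_y ↦ −θ_y`: the weight is invariant, the observable changes sign; Haar
invariance `integral_torusHaar_mul_right`). [folklore] -/
private theorem integral_cosDiff_mul_ginibreWeight_eq_zero_of_isolated {J : V × V → ℝ} {x y : V} (hxy : x ≠ y)
    (hy : ∀ z, J (y, z) = 0 ∧ J (z, y) = 0) :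
    ∫ θ, cosDiff x y θ * ginibreWeight (pairChars V) J θ ∂torusHaar V = 0 := by
  -- adapted from the private `twoPoint_eq_zero_of_isolated` of `PlaneRotatorLiebRivasseauInequality.lean`
  set φ : V → Circle := (Pi.mulSingle y (-1 : Circle))⁻¹ with hφ
  have hH : ∀ θ : V → Circle, ginibreHamiltonian (pairChars V) J (θ * φ) = ginibreHamiltonian (pairChars V) J θ := by
    intro θ
    unfold ginibreHamiltonian
    refine Finset.sum_congr rfl fun p _ => ?_
    by_cases h1 : p.1 = y
    · rw [show p = (y, p.2) from Prod.ext h1 rfl, (hy p.2).1, zero_mul, zero_mul]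
    by_cases h2 : p.2 = y
    · rw [show p = (p.1, y) from Prod.ext rfl h2, (hy p.1).2, zero_mul, zero_mul]
    congr 1
    simp [reChar, pairChars_apply, hφ, h1, h2]
  have hW : ∀ θ : V → Circle, ginibreWeight (pairChars V) J (θ * φ) = ginibreWeight (pairChars V) J θ := fun θ => by
    rw [ginibreWeight, ginibreWeight, hH]
  have hnum : ∫ θ, cosDiff x y θ * ginibreWeight (pairChars V) J θ ∂torusHaar V =
      -∫ θ, cosDiff x y θ * ginibreWeight (pairChars V) J θ ∂torusHaar V := by
    have h := integral_torusHaar_mul_right (fun θ => cosDiff x y θ * ginibreWeight (pairChars V) J θ) φ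
    simp_rw [hW] at h
    simp only [hφ, cosDiff_mul_inv_mulSingle_neg_one hxy, neg_mul, integral_neg] at h
    exact h.symm
  linarith

/-- **The one-site heat-bath bound** (folklore «finite energy»): for ferromagnetic pair couplings `J ≥ 0`, `x ≠ y` and
`∑_z (J(x,z) + J(z,x)) ≤ S`, `⟨cos(θ_x − θ_y)⟩_J ≤ 1 − exp(−2S)`: conditionally on all other spins the density of `θ_x`
lies between `e^{−S}` and `e^{S}` relative to the free spin, whose `cos` averages to zero.
[cite: Ginibre1970, Example 4 (plane rotators; the model)] -/
theorem twoPoint_le_one_sub_exp_of_rowSum_le {J : V × V → ℝ} (hJ : ∀ p, 0 ≤ J p) {x y : V} (hxy : x ≠ y)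
    {S : ℝ} (hS : ∑ z, (J (x, z) + J (z, x)) ≤ S) :
    twoPoint J x y ≤ 1 - Real.exp (-2 * S) := by
  rw [twoPoint_comm, twoPoint, ginibreExpect]
  -- the star of `x` and the rest
  set J₁ : V × V → ℝ := fun p => if p.1 = x ∨ p.2 = x then J p else 0 with hJ₁
  set J₀ : V × V → ℝ := fun p => if p.1 = x ∨ p.2 = x then 0 else J p with hJ₀
  have hsplit : J = J₀ + J₁ := by
    funext p
    simp only [Pi.add_apply, hJ₀, hJ₁]
    split_ifs <;> simp
  have hJ₁0 : ∀ p, 0 ≤ J₁ p := fun p => by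
    simp only [hJ₁]
    split_ifs
    · exact hJ p
    · exact le_rfl
  -- `∑_p J₁ p ≤ S`
  have hJ₁le : ∀ a b : V, J₁ (a, b) ≤ (if a = x then J (a, b) else 0) + (if b = x then J (a, b) else 0) := by
    intro a b
    have h0 : 0 ≤ J (a, b) := hJ (a, b)
    simp only [hJ₁]
    split_ifs <;> first | linarith | tauto
  have hA : ∑ a, ∑ b, (if a = x then J (a, b) else 0) = ∑ b, J (x, b) := by
    rw [Finset.sum_comm]
    refine Finset.sum_congr rfl fun b _ => ?_
    rw [Finset.sum_ite_eq']
    simp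
  have hB : ∑ a, ∑ b, (if b = x then J (a, b) else 0) = ∑ a, J (a, x) := by
    refine Finset.sum_congr rfl fun a _ => ?_
    rw [Finset.sum_ite_eq']
    simp
  have hsum : ∑ p, J₁ p ≤ S := by
    refine le_trans ?_ hS
    rw [Fintype.sum_prod_type]
    calc ∑ a, ∑ b, J₁ (a, b)
        ≤ ∑ a, ∑ b, ((if a = x then J (a, b) else 0) + (if b = x then J (a, b) else 0)) :=
          Finset.sum_le_sum fun a _ => Finset.sum_le_sum fun b _ => hJ₁le a b
      _ = ∑ b, J (x, b) + ∑ a, J (a, x) := by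
          simp only [Finset.sum_add_distrib]
          rw [hA, hB]
      _ = ∑ z, (J (x, z) + J (z, x)) := by rw [← Finset.sum_add_distrib]
  -- `|H_{J₁}| ≤ S`
  have hH₁ : ∀ θ : V → Circle, |ginibreHamiltonian (pairChars V) J₁ θ| ≤ S := by
    intro θ
    unfold ginibreHamiltonian
    refine (Finset.abs_sum_le_sum_abs _ _).trans (le_trans (Finset.sum_le_sum fun p _ => ?_) hsum)
    rw [abs_mul, abs_of_nonneg (hJ₁0 p)]
    exact mul_le_of_le_one_right (hJ₁0 p) (abs_reChar_le_one _ _)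
  -- weights
  set W : (V → Circle) → ℝ := ginibreWeight (pairChars V) J with hWdef
  set W₀ : (V → Circle) → ℝ := ginibreWeight (pairChars V) J₀ with hW₀def
  set W₁ : (V → Circle) → ℝ := ginibreWeight (pairChars V) J₁ with hW₁def
  have hW : ∀ θ, W θ = W₀ θ * W₁ θ := fun θ => by
    rw [hWdef, hW₀def, hW₁def, ← ginibreWeight_add, ← hsplit]
  have hW₀pos : ∀ θ, 0 < W₀ θ := fun θ => Real.exp_pos _
  have hW₁lo : ∀ θ, Real.exp (-S) ≤ W₁ θ := fun θ => by
    rw [hW₁def, ginibreWeight]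
    exact Real.exp_le_exp.2 (abs_le.1 (hH₁ θ)).1
  have hW₁hi : ∀ θ, W₁ θ ≤ Real.exp S := fun θ => by
    rw [hW₁def, ginibreWeight]
    exact Real.exp_le_exp.2 (abs_le.1 (hH₁ θ)).2
  -- continuity / integrability
  have hWc : Continuous W := continuous_ginibreWeight (pairChars V) J
  have hW₀c : Continuous W₀ := continuous_ginibreWeight (pairChars V) J₀
  have hcos : Continuous (cosDiff y x : (V → Circle) → ℝ) := continuous_cosDiff y x
  -- `x` is free under `J₀`
  have hiso : ∀ z, J₀ (x, z) = 0 ∧ J₀ (z, x) = 0 := fun z => by simp [hJ₀]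
  have hI0 : ∫ θ, cosDiff y x θ * W₀ θ ∂torusHaar V = 0 :=
    integral_cosDiff_mul_ginibreWeight_eq_zero_of_isolated hxy.symm hiso
  -- the partition function
  have hZ : 0 < ∫ θ, W θ ∂torusHaar V := integral_exp_pos (integrable_torusHaar_of_continuous hWc)
  -- `e^{-S} ∫ (1 - cos) W₀ ≤ ∫ (1 - cos) W`
  have h1 : Real.exp (-S) * ∫ θ, (1 - cosDiff y x θ) * W₀ θ ∂torusHaar V ≤
      ∫ θ, (1 - cosDiff y x θ) * W θ ∂torusHaar V := by
    rw [← integral_const_mul]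
    refine integral_mono (integrable_torusHaar_of_continuous (continuous_const.mul
        ((continuous_const.sub hcos).mul hW₀c)))
      (integrable_torusHaar_of_continuous ((continuous_const.sub hcos).mul hWc)) fun θ => ?_
    have hc : 0 ≤ 1 - cosDiff y x θ := by
      have := (le_abs_self _).trans (abs_cosDiff_le_one y x θ)
      linarith
    have hkey := mul_le_mul_of_nonneg_left (hW₁lo θ) (mul_nonneg hc (hW₀pos θ).le)
    dsimp only
    rw [hW θ]
    linarith
  -- `∫ (1 - cos) W₀ = ∫ W₀`
  have h2 : ∫ θ, (1 - cosDiff y x θ) * W₀ θ ∂torusHaar V = ∫ θ, W₀ θ ∂torusHaar V := by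
    simp_rw [sub_mul, one_mul]
    have hi : Integrable (fun θ => cosDiff y x θ * W₀ θ) (torusHaar V) :=
      integrable_torusHaar_of_continuous (hcos.mul hW₀c)
    rw [integral_sub (integrable_torusHaar_of_continuous hW₀c) hi, hI0, sub_zero]
  -- `e^{-S} ∫ W ≤ ∫ W₀`
  have h3 : Real.exp (-S) * ∫ θ, W θ ∂torusHaar V ≤ ∫ θ, W₀ θ ∂torusHaar V := by
    rw [← integral_const_mul]
    refine integral_mono (integrable_torusHaar_of_continuous (continuous_const.mul hWc))
      (integrable_torusHaar_of_continuous hW₀c) fun θ => ?_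
    dsimp only
    rw [hW θ]
    calc Real.exp (-S) * (W₀ θ * W₁ θ) ≤ Real.exp (-S) * (W₀ θ * Real.exp S) :=
          mul_le_mul_of_nonneg_left (mul_le_mul_of_nonneg_left (hW₁hi θ) (hW₀pos θ).le) (Real.exp_pos _).le
      _ = W₀ θ := by rw [mul_left_comm, ← Real.exp_add, neg_add_cancel, Real.exp_zero, mul_one]
  -- `∫ (1 - cos) W = Z - N`
  have h4 : ∫ θ, (1 - cosDiff y x θ) * W θ ∂torusHaar V =
      (∫ θ, W θ ∂torusHaar V) - ∫ θ, cosDiff y x θ * W θ ∂torusHaar V := by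
    simp_rw [sub_mul, one_mul]
    have hi : Integrable (fun θ => cosDiff y x θ * W θ) (torusHaar V) :=
      integrable_torusHaar_of_continuous (hcos.mul hWc)
    rw [integral_sub (integrable_torusHaar_of_continuous hWc) hi]
  have h5 : Real.exp (-2 * S) = Real.exp (-S) * Real.exp (-S) := by
    rw [← Real.exp_add]
    congr 1
    ring
  -- assemble
  have key : Real.exp (-2 * S) * ∫ θ, W θ ∂torusHaar V ≤
      (∫ θ, W θ ∂torusHaar V) - ∫ θ, cosDiff y x θ * W θ ∂torusHaar V := by
    rw [← h4, h5, mul_assoc]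
    refine le_trans (mul_le_mul_of_nonneg_left h3 (Real.exp_pos _).le) ?_
    rw [← h2]
    exact h1
  rw [div_le_iff₀ hZ]
  linarith

end HeatBath

/-! ## §1b The layered model: `⟨cos(θ_a − θ_c)⟩_Λ ≤ 1 − e^{−2β(4J∥+2J⊥)}` off the diagonal -/

section Layered

open Literature.Barriers.CriticalPhenomena Literature.Barriers.CriticalPhenomena.LongRangeIsing

variable [MeasurableSpace Circle] [BorelSpace Circle]

variable {β Jp Jz : ℝ}

/-- **Off-diagonal bound for the layered XY model**, uniformly in the volume: for `β, J∥, J⊥ ≥ 0`, every finite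
`Λ ⊂ ℤ³` and `a ≠ c` in `Λ`, `⟨cos(θ_a − θ_c)⟩_{Λ;β,J∥,J⊥} ≤ 1 − exp(−2β(4J∥ + 2J⊥))` (heat-bath bound with the row sum
`∑_y (J(a,y) + J(y,a)) ≤ β(4J∥ + 2J⊥)`, tree `sum_layeredXYCoupling_le`). [cite: LiuStanley1972, p. 272 (layers (J, J, εJ))] -/
theorem twoPoint_layered_le_one_sub_exp (hβ : 0 ≤ β) (hp : 0 ≤ Jp) (hz : 0 ≤ Jz) (Λ : Finset (Site 3))
    {a c : Λ} (hac : a ≠ c) :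
    twoPoint (layeredXYCoupling β Jp Jz Λ) a c ≤ 1 - Real.exp (-2 * (β * (4 * Jp + 2 * Jz))) := by
  classical
  exact twoPoint_le_one_sub_exp_of_rowSum_le (layeredXYCoupling_nonneg hβ hp hz Λ) hac
    (sum_layeredXYCoupling_le hβ hp hz Λ a)

/-- The same bound for the infinite-volume free two-point function: `G^{3D,free,∞}_{β;J∥,J⊥}(x, y) ≤ 1 − e^{−2β(4J∥+2J⊥)}`
for `x ≠ y`. [cite: Ginibre1970, Prop. 3 with Example 4 (plane rotators)] -/
theorem infTwoPointLayered_le_one_sub_exp (hβ : 0 ≤ β) (hp : 0 ≤ Jp) (hz : 0 ≤ Jz) {x y : Site 3} (hxy : x ≠ y) :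
    infTwoPointLayered β Jp Jz x y ≤ 1 - Real.exp (-2 * (β * (4 * Jp + 2 * Jz))) := by
  refine infTwoPointLayered_le_of_forall_box fun n => ?_
  by_cases h : x ∈ box 3 n ∧ y ∈ box 3 n
  · rw [volTwoPointLayered_of_mem β Jp Jz h.1 h.2]
    exact twoPoint_layered_le_one_sub_exp hβ hp hz (box 3 n) fun hxy' => hxy (congrArg Subtype.val hxy')
  · unfold volTwoPointLayered
    rw [dif_neg h, sub_nonneg]
    have : 0 ≤ β * (4 * Jp + 2 * Jz) := mul_nonneg hβ (by linarith)
    exact Real.exp_le_one_iff.2 (by linarith)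

end Layered

/-! ## §2 A Bernoulli envelope: off-diagonal bound + block decay ⇒ one geometric law -/

section Envelope

/-- **Geometric envelope.** If `0 ≤ m < 1`, `ρ < 1` and `R ≥ 1`, there is `0 ≤ r < 1` such that every `g` with `g ≤ ρ` and
`g ≤ m^{⌊n/R⌋}` (`n ≥ 1`) satisfies `g ≤ r^n`: take `q = max(½, m, ρ)` and `r = 1 − (1 − q)/(2R)`, so that `q ≤ r^{2R}`
(Bernoulli); for `n < R` use `g ≤ q ≤ r^{2R} ≤ r^n`, for `n ≥ R` use `g ≤ q^{⌊n/R⌋} ≤ r^{2R⌊n/R⌋} ≤ r^n`. [folklore] -/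
private theorem exists_geometric_envelope {m ρ : ℝ} (hm0 : 0 ≤ m) (hm1 : m < 1) (hρ : ρ < 1) {R : ℕ} (hR : 1 ≤ R) :
    ∃ r : ℝ, 0 ≤ r ∧ r < 1 ∧
      ∀ n : ℕ, 1 ≤ n → ∀ g : ℝ, g ≤ ρ → g ≤ m ^ (n / R) → g ≤ r ^ n := by
  set q : ℝ := max (1 / 2) (max m ρ) with hq
  have hq1 : q < 1 := max_lt (by norm_num) (max_lt hm1 hρ)
  have hqh : 1 / 2 ≤ q := le_max_left _ _
  have hq0 : 0 ≤ q := le_trans (by norm_num) hqh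
  have hmq : m ≤ q := (le_max_left _ _).trans (le_max_right _ _)
  have hρq : ρ ≤ q := (le_max_right _ _).trans (le_max_right _ _)
  have hRpos : (0 : ℝ) < R := by exact_mod_cast hR
  set r : ℝ := 1 - (1 - q) / (2 * R) with hr
  have hfrac_pos : 0 < (1 - q) / (2 * R) := div_pos (by linarith) (by linarith)
  have hR1 : (1 : ℝ) ≤ R := by exact_mod_cast hR
  have hR0 : (R : ℝ) ≠ 0 := hRpos.ne'
  have hfrac_le : (1 - q) / (2 * R) ≤ 1 / 4 := by
    rw [div_le_iff₀ (by linarith : (0 : ℝ) < 2 * R)]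
    linarith
  have hr0 : 0 ≤ r := by rw [hr]; linarith
  have hr1 : r < 1 := by rw [hr]; linarith
  -- Bernoulli: `q ≤ r ^ (2R)`
  have hbern : q ≤ r ^ (2 * R) := by
    have h := one_add_mul_le_pow (show (-2 : ℝ) ≤ -((1 - q) / (2 * R)) by linarith) (2 * R)
    have e1 : (1 : ℝ) + (2 * R : ℕ) * -((1 - q) / (2 * R)) = q := by
      push_cast
      field_simp
      ring
    have e2 : (1 : ℝ) + -((1 - q) / (2 * R)) = r := by rw [hr]; ring
    rw [e1, e2] at h
    exact h
  refine ⟨r, hr0, hr1, fun n hn g hgρ hgm => ?_⟩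
  by_cases hnR : n < R
  · calc g ≤ q := hgρ.trans hρq
      _ ≤ r ^ (2 * R) := hbern
      _ ≤ r ^ n := pow_le_pow_of_le_one hr0 hr1.le (by omega)
  · have hRn : R ≤ n := not_lt.1 hnR
    have hj : 1 ≤ n / R := (Nat.one_le_div_iff (by omega)).2 hRn
    have hlt : n < n / R * R + R := Nat.lt_div_mul_add (by omega)
    have hjR : R ≤ n / R * R := by simpa using Nat.mul_le_mul_right R hj
    have hn2 : n ≤ 2 * R * (n / R) := by
      have e : 2 * R * (n / R) = n / R * R + n / R * R := by ring
      rw [e]; omega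
    calc g ≤ m ^ (n / R) := hgm
      _ ≤ q ^ (n / R) := pow_le_pow_left₀ hm0 hmq _
      _ ≤ (r ^ (2 * R)) ^ (n / R) := pow_le_pow_left₀ hq0 hbern _
      _ = r ^ (2 * R * (n / R)) := (pow_mul r (2 * R) (n / R)).symm
      _ ≤ r ^ n := pow_le_pow_of_le_one hr0 hr1.le hn2

end Envelope

/-! ## §3 Finite stack susceptibility ⇒ `∃ r < 1, ⟨cos(θ_a − θ_c)⟩_Λ ≤ r^{‖a−c‖_∞} ≤ r^{|ℓ(a)−ℓ(c)|}` in every volume -/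

section UniformDecay

open Literature.Barriers.CriticalPhenomena Literature.Barriers.CriticalPhenomena.LongRangeIsing

variable [MeasurableSpace Circle] [BorelSpace Circle]

variable {β Jp Jz : ℝ}

/-- **Finite susceptibility ⇒ uniform, prefactor-free geometric decay in the sup norm.** If
`∑_{z ∈ ℤ³} G^{3D,free,∞}_{β;J∥,J⊥}(0, z) < ∞` (`β, J∥, J⊥ ≥ 0`) then for some `0 ≤ r < 1`:
`⟨cos(θ_a − θ_c)⟩_{Λ;β,J∥,J⊥} ≤ r^{‖a − c‖_∞}` for every finite `Λ ⊂ ℤ³` and all `a, c ∈ Λ` (Simon–Lieb cube decay of the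
infinite-volume function, Griffiths–Ginibre domination of every finite volume, the off-diagonal heat-bath bound, envelope).
[cite: Simon1980CMP, Thm 1.3 (Σ⟨σ₀σ_x⟩ < ∞ ⇒ exponential decay); Lieb1980, Theorem 4 and p. 128 (boxes)] -/
theorem exists_uniform_geometric_decay_of_summable (hβ : 0 ≤ β) (hp : 0 ≤ Jp) (hz : 0 ≤ Jz)
    (hG : Summable fun z : Site 3 => infTwoPointLayered β Jp Jz 0 z) :
    ∃ r : ℝ, 0 ≤ r ∧ r < 1 ∧ ∀ (Λ : Finset (Site 3)) (a c : Λ),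
      twoPoint (layeredXYCoupling β Jp Jz Λ) a c ≤ r ^ Site.supNorm ((a : Site 3) - (c : Site 3)) := by
  obtain ⟨R, hR, m, hm0, hm1, hdec⟩ := infTwoPointLayered_decay_of_summable hβ hp hz hG
  have hρ : 1 - Real.exp (-2 * (β * (4 * Jp + 2 * Jz))) < 1 := by linarith [Real.exp_pos (-2 * (β * (4 * Jp + 2 * Jz)))]
  obtain ⟨r, hr0, hr1, henv⟩ := exists_geometric_envelope hm0 hm1 hρ hR
  refine ⟨r, hr0, hr1, fun Λ a c => ?_⟩
  rcases Nat.eq_zero_or_pos (Site.supNorm ((a : Site 3) - (c : Site 3))) with hn | hn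
  · rw [hn, pow_zero]
    exact twoPoint_le_one _ _ _
  · have hac : a ≠ c := by
      intro h
      rw [h, sub_self, Site.supNorm_eq_zero_iff.2 rfl] at hn
      exact lt_irrefl 0 hn
    exact henv _ hn _ (twoPoint_layered_le_one_sub_exp hβ hp hz Λ hac)
      ((twoPoint_layered_le_inf hβ hp hz Λ a c).trans (hdec _ _))

/-- **Finite susceptibility ⇒ uniform geometric decay ACROSS THE LAYERS** (the premise shape of the cell's K5
dictionary, `LayeredXYDecayAt`): if `∑_z G^{3D,free,∞}_{β;J∥,J⊥}(0, z) < ∞` then for some `0 ≤ r < 1`,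
`⟨cos(θ_a − θ_c)⟩_{Λ;β,J∥,J⊥} ≤ r^{|ℓ(a) − ℓ(c)|}` for every finite `Λ ⊂ ℤ³` and all `a, c ∈ Λ` (`|ℓ(a) − ℓ(c)| ≤ ‖a − c‖_∞`).
[cite: Simon1980CMP, Thm 1.3; Lieb1980, eq. (23) and notes added in proof (2)] -/
theorem exists_uniform_layer_decay_of_summable (hβ : 0 ≤ β) (hp : 0 ≤ Jp) (hz : 0 ≤ Jz)
    (hG : Summable fun z : Site 3 => infTwoPointLayered β Jp Jz 0 z) :
    ∃ r : ℝ, 0 ≤ r ∧ r < 1 ∧ ∀ (Λ : Finset (Site 3)) (a c : Λ),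
      twoPoint (layeredXYCoupling β Jp Jz Λ) a c ≤ r ^ (layer a - layer c).natAbs := by
  obtain ⟨r, hr0, hr1, h⟩ := exists_uniform_geometric_decay_of_summable hβ hp hz hG
  refine ⟨r, hr0, hr1, fun Λ a c => (h Λ a c).trans (pow_le_pow_of_le_one hr0 hr1.le ?_)⟩
  have e : layer a - layer c = ((a : Site 3) - (c : Site 3)) 2 := by simp [layer]
  rw [e]
  exact Site.natAbs_le_supNorm _ 2

/-- **On the whole finite-susceptibility phase of the stack**: for `Δ, K ≥ 0` with `ofReal K < K_χ^{3D}(Δ)` (tree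
`layeredSusceptibilityCriticalCoupling`; `summable_layered_of_ofReal_lt`), the layered model with reduced couplings
`(K∥, K⊥) = (K, ΔK)` decays geometrically across the layers, uniformly in the volume, without prefactor.
[cite: LiuStanley1972, p. 272 (T_c(ε) of the layers (J, J, εJ)); Simon1980CMP, Thm 1.3] -/
theorem exists_uniform_layer_decay_of_lt_layeredSusceptibilityCriticalCoupling {Δ K : ℝ} (hΔ : 0 ≤ Δ) (hK : 0 ≤ K)
    (h : ENNReal.ofReal K < layeredSusceptibilityCriticalCoupling Δ) :
    ∃ r : ℝ, 0 ≤ r ∧ r < 1 ∧ ∀ (Λ : Finset (Site 3)) (a c : Λ),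
      twoPoint (layeredXYCoupling 1 K (Δ * K) Λ) a c ≤ r ^ (layer a - layer c).natAbs :=
  exists_uniform_layer_decay_of_summable zero_le_one hK (mul_nonneg hΔ hK) (summable_layered_of_ofReal_lt hΔ hK h)

/-- **Temperature form**: for `β, J∥ ≥ 0`, `Δ ≥ 0` and `ofReal(βJ∥) < K_χ^{3D}(Δ)`, the layered model at inverse temperature
`β` with couplings `(J∥, ΔJ∥)` decays geometrically across the layers, uniformly in the volume, without prefactor
(Griffiths–Ginibre: the couplings `(β; J∥, ΔJ∥)` and `(1; βJ∥, ΔβJ∥)` give the same free two-point functions up to the tree's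
monotone comparison `summable_layered_of_mul_le`). [cite: LiuStanley1972, p. 272; Ginibre1970, Prop. 3 with Example 4] -/
theorem exists_uniform_layer_decay_of_mul_lt_layeredSusceptibilityCriticalCoupling {Δ : ℝ} (hΔ : 0 ≤ Δ) (hβ : 0 ≤ β)
    (hp : 0 ≤ Jp) (h : ENNReal.ofReal (β * Jp) < layeredSusceptibilityCriticalCoupling Δ) :
    ∃ r : ℝ, 0 ≤ r ∧ r < 1 ∧ ∀ (Λ : Finset (Site 3)) (a c : Λ),
      twoPoint (layeredXYCoupling β Jp (Δ * Jp) Λ) a c ≤ r ^ (layer a - layer c).natAbs := by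
  have hK : 0 ≤ β * Jp := mul_nonneg hβ hp
  have hsum := summable_layered_of_ofReal_lt hΔ hK h
  refine exists_uniform_layer_decay_of_summable hβ hp (mul_nonneg hΔ hp) ?_
  exact summable_layered_of_mul_le hβ hp (mul_nonneg hΔ hp) le_rfl (le_of_eq (by ring)) hsum

end UniformDecay

end PlaneRotator

end Literature.Probability.LatticeModels
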